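import Summits.NavierStokesRegularity.NavierStokesRegularity.Theorems.FilamentSkeletonRssNoExactProfileAdjointEnergy

/-!
# Route `FilamentSkeletonRss` · negative item `NoExactProfileNearSymmetricPair` (stmt-NavierStokesRegularity-24091) — S_γ groundwork (B8):
# the CACCIOPPOLI IDENTITY for the steady vorticity equation in rotating similarity variables (first step of the interior-regularity brick (M-a))

Helper file (theorems only), `--supports stmt-NavierStokesRegularity-24091 --as helper`; LEAD of 23611 / registrar of 23920, lane ns-filament-21221-p1 g15.

WHY.  The LEAD memo (`Cruxes/TransverseReductionRJ/Lines/defect_column_gate_1AR_B2_gamma_LEAD15.md`, (A2), (M-a)) needs interior estimates for the vorticity `Ω = curl U` of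
a hypothetical exact profile from weak data, in the PRESSURE-FREE vorticity form.  Integrating the pointwise energy identity `Δq − Dq[v] − 2q + 2⟪DU·Ω,Ω⟫ = 2‖DΩ‖²_F`
(`vorticityOp_normSq` twin in `…AdjointEnergy`, `q = |Ω|²`, `v = U + ½y − αe₃×y`, `div v = 3/2`) against `η²`, `η ∈ C²_c`, and removing every derivative of `q` by the
divergence theorem on the whole space gives

  `2∫ η²‖DΩ‖²_F + ½∫ η²|Ω|² = ∫ |Ω|²·(Δ(η²) + 2ηDη[v]) + 2∫ η²⟪DU·Ω, Ω⟫`   (`vorticity_caccioppoli_identity`).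

Note the COERCIVE term `+½∫η²|Ω|²` (from `div v = 3/2` against the `+Ω` of the backward-Leray vorticity operator): wherever the strain along `Ω` is `≤ s < ¼`, BOTH
`∫η²‖DΩ‖²` and `∫η²|Ω|²` are controlled by the mass of `|Ω|²` on the cut-off LAYER weighted by `|Δ(η²)| + 2|η||Dη||v|` — an `L²` «no vorticity sits in a low-strain region unless
fed through its boundary» statement (`vorticity_caccioppoli_estimate`).
HONEST FRAMING: groundwork on the NEGATIVE side of a HYPOTHETICAL filament-type rotating-self-similar blow-up route (MODEL rung); 24091/23611/23920 OPEN; nothing here bears on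
Navier–Stokes regularity, which is NOT proved.
-/

set_option linter.dupNamespace false

noncomputable section

namespace Summit.NavierStokesRegularity.NavierStokesRegularity.Theorems.DefectColumnGate

open scoped BigOperators Topology InnerProductSpace Laplacian ContDiff
open Set Function MeasureTheory
open Literature.Analysis.FluidPDE
open Summit.NavierStokesRegularity.NavierStokesRegularity.Theorems.KelvinGate

/-- The gradient of a `C^{n+1}` scalar is `Cⁿ`. -/
theorem contDiff_gradient_of_contDiff_succ {φ : EuclideanSpace ℝ (Fin 3) → ℝ} {n : ℕ∞} (hφ : ContDiff ℝ (n + 1) φ) :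
    ContDiff ℝ n (gradient φ) := by
  have e1 : gradient φ = fun y => (InnerProductSpace.toDual ℝ (EuclideanSpace ℝ (Fin 3))).symm (fderiv ℝ φ y) := rfl
  rw [e1]
  exact (InnerProductSpace.toDual ℝ (EuclideanSpace ℝ (Fin 3))).symm.toContinuousLinearEquiv.contDiff.comp (hφ.fderiv_right le_rfl)

/-- `div(∇φ) = Δφ` for `C²` scalars on `ℝ³`. -/
theorem divergence_gradient_eq_laplacian {φ : EuclideanSpace ℝ (Fin 3) → ℝ} (hφ : ContDiff ℝ 2 φ) (x : EuclideanSpace ℝ (Fin 3)) :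
    VectorCalculus.divergence (gradient φ) x = (Δ φ) x := by
  set b := stdOrthonormalBasis ℝ (EuclideanSpace ℝ (Fin 3))
  rw [divergence_eq_sum_inner_fderiv b, laplacian_eq_sum_fderiv_fderiv b hφ]
  refine Finset.sum_congr rfl fun i _ => ?_
  have hd : DifferentiableAt ℝ (fderiv ℝ φ) x := ((hφ.fderiv_right (m := 1) le_rfl).differentiable one_ne_zero) x
  have e1 : gradient φ = (InnerProductSpace.toDual ℝ (EuclideanSpace ℝ (Fin 3))).symm.toContinuousLinearEquiv ∘ fderiv ℝ φ := rfl
  rw [e1, ContinuousLinearEquiv.comp_fderiv, fderiv_clm_apply hd (differentiableAt_const _)]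
  simp only [ContinuousLinearMap.coe_comp, ContinuousLinearEquiv.coe_coe, Function.comp_apply,
    LinearIsometryEquiv.coe_toContinuousLinearEquiv, fderiv_fun_const, Pi.zero_apply,
    ContinuousLinearMap.comp_zero, zero_add, ContinuousLinearMap.flip_apply]
  rw [real_inner_comm, InnerProductSpace.toDual_symm_apply]

/-- The frame field `v = U + ½y − αe₃×y` has divergence `3/2` for solenoidal `U`. -/
theorem divergence_frameField {U : EuclideanSpace ℝ (Fin 3) → EuclideanSpace ℝ (Fin 3)} (hU : ContDiff ℝ 1 U) (hdiv : VectorCalculus.IsDivFree U) (α : ℝ)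
    (y : EuclideanSpace ℝ (Fin 3)) :
    VectorCalculus.divergence (fun z => U z + (1/2:ℝ) • z - α • cross (EuclideanSpace.single 2 1) z) y = 3 / 2 := by
  have hU1 : Differentiable ℝ U := hU.differentiable (by norm_num)
  have hdv : HasFDerivAt (fun z => U z + (1/2:ℝ) • z - α • cross (EuclideanSpace.single 2 1) z)
      (fderiv ℝ U y + (1/2:ℝ) • ContinuousLinearMap.id ℝ _ - α • rotGenL) y := by
    have h : HasFDerivAt (fun z => U z + (1/2:ℝ) • z - α • rotGenL z)
        (fderiv ℝ U y + (1/2:ℝ) • ContinuousLinearMap.id ℝ _ - α • rotGenL) y :=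
      ((hU1 y).hasFDerivAt.add ((hasFDerivAt_id y).const_smul (1/2:ℝ))).sub ((rotGenL.hasFDerivAt (x := y)).const_smul α)
    have e : (fun z => U z + (1/2:ℝ) • z - α • cross (EuclideanSpace.single 2 1) z) = fun z => U z + (1/2:ℝ) • z - α • rotGenL z := by
      funext z; rw [cross_single_two_eq_rotGenL]
    rw [e]; exact h
  rw [divergence_eq_sum_inner_fderiv (EuclideanSpace.basisFun (Fin 3) ℝ), hdv.fderiv]
  simp only [FunLike.coe_sub, Pi.sub_apply, FunLike.coe_add, Pi.add_apply, FunLike.coe_smul, Pi.smul_apply, ContinuousLinearMap.id_apply, rotGenL_apply,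
    inner_sub_right, inner_add_right, real_inner_smul_right, Finset.sum_sub_distrib, Finset.sum_add_distrib, ← Finset.mul_sum,
    sum_inner_basisFun_rotGen, sum_inner_basisFun_self]
  have h0 : ∑ i : Fin 3, ⟪EuclideanSpace.basisFun (Fin 3) ℝ i, fderiv ℝ U y (EuclideanSpace.basisFun (Fin 3) ℝ i)⟫_ℝ = 0 := by
    rw [← divergence_eq_sum_inner_fderiv]; exact hdiv y
  rw [h0]; ring

/-- **CACCIOPPOLI IDENTITY FOR THE STEADY VORTICITY EQUATION.**  Let `U ∈ C¹` be solenoidal, `Ω ∈ C²` a solution of the steady vorticity equation `𝒯_UΩ = 0` on `ℝ³`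
(`𝒯_UΩ = α(e₃×Ω − DΩ[e₃×y]) + Ω + ½DΩ[y] − ΔΩ + DΩ[U] − DU[Ω]`), and `η ∈ C²` compactly supported.  Then, with `v = U + ½y − αe₃×y`,
`2∫ η²‖DΩ‖²_F + ½∫ η²|Ω|² = ∫ |Ω|²·(Δ(η²) + 2ηDη[v]) + 2∫ η²⟪DU·Ω, Ω⟫`. -/
theorem vorticity_caccioppoli_identity (α : ℝ) {U Ω : EuclideanSpace ℝ (Fin 3) → EuclideanSpace ℝ (Fin 3)} (hU : ContDiff ℝ 1 U)
    (hdiv : VectorCalculus.IsDivFree U) (hΩ : ContDiff ℝ 2 Ω)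
    (hvort : ∀ y, α • (cross (EuclideanSpace.single 2 1) (Ω y) - fderiv ℝ Ω y (cross (EuclideanSpace.single 2 1) y)) + Ω y + (1/2:ℝ) • fderiv ℝ Ω y y
        - (Δ Ω) y + fderiv ℝ Ω y (U y) - fderiv ℝ U y (Ω y) = 0)
    {η : EuclideanSpace ℝ (Fin 3) → ℝ} (hη : ContDiff ℝ 2 η) (hηc : HasCompactSupport η) :
    2 * (∫ y, η y ^ 2 * frobeniusNormSq (fderiv ℝ Ω y)) + (1/2:ℝ) * (∫ y, η y ^ 2 * ⟪Ω y, Ω y⟫_ℝ)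
      = (∫ y, ⟪Ω y, Ω y⟫_ℝ * ((Δ (fun z => η z ^ 2)) y + 2 * η y * fderiv ℝ η y (U y + (1/2:ℝ) • y - α • cross (EuclideanSpace.single 2 1) y)))
        + 2 * ∫ y, η y ^ 2 * ⟪fderiv ℝ U y (Ω y), Ω y⟫_ℝ := by
  -- regularity of `q = |Ω|²`, `θ = η²`, `v`, and of the gradients
  have hq : ContDiff ℝ 2 (fun z : EuclideanSpace ℝ (Fin 3) => ⟪Ω z, Ω z⟫_ℝ) := hΩ.inner ℝ hΩ
  have hq1 : ContDiff ℝ 1 (fun z : EuclideanSpace ℝ (Fin 3) => ⟪Ω z, Ω z⟫_ℝ) := hq.of_le (by norm_num)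
  have hθ : ContDiff ℝ 2 (fun z : EuclideanSpace ℝ (Fin 3) => η z ^ 2) := hη.pow 2
  have hθ1 : ContDiff ℝ 1 (fun z : EuclideanSpace ℝ (Fin 3) => η z ^ 2) := hθ.of_le (by norm_num)
  have hv : ContDiff ℝ 1 (fun z : EuclideanSpace ℝ (Fin 3) => U z + (1/2:ℝ) • z - α • cross (EuclideanSpace.single 2 1) z) := by
    simp only [cross_single_two_eq_rotGenL]
    exact (hU.add (contDiff_id.const_smul _)).sub (rotGenL.contDiff.const_smul _)
  have hgq : ContDiff ℝ 1 (gradient (fun z : EuclideanSpace ℝ (Fin 3) => ⟪Ω z, Ω z⟫_ℝ)) := contDiff_gradient_of_contDiff_succ (n := 1) hq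
  have hgθ : ContDiff ℝ 1 (gradient (fun z : EuclideanSpace ℝ (Fin 3) => η z ^ 2)) := contDiff_gradient_of_contDiff_succ (n := 1) hθ
  have hθsub : tsupport (fun z : EuclideanSpace ℝ (Fin 3) => η z ^ 2) ⊆ tsupport η := closure_mono fun z hz => by
    simp only [mem_support] at hz ⊢
    exact fun h0 => hz (by simp [h0])
  have hθc : HasCompactSupport (fun z : EuclideanSpace ℝ (Fin 3) => η z ^ 2) :=
    HasCompactSupport.intro' hηc (isClosed_tsupport η) fun y hy => by simp [image_eq_zero_of_notMem_tsupport hy]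
  have hgθ0 : ∀ y ∉ tsupport η, gradient (fun z : EuclideanSpace ℝ (Fin 3) => η z ^ 2) y = 0 := fun y hy =>
    gradient_eq_zero_of_notMem_tsupport (fun h => hy (hθsub h))
  have hθ0 : ∀ y ∉ tsupport η, η y ^ 2 = 0 := fun y hy => by simp [image_eq_zero_of_notMem_tsupport hy]
  have hΔθ0 : ∀ y ∉ tsupport η, (Δ (fun z : EuclideanSpace ℝ (Fin 3) => η z ^ 2)) y = 0 := fun y hy =>
    laplacian_eq_zero_of_notMem_tsupport (fun h => hy (hθsub h))
  -- derivative of `η²`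
  have hDθ : ∀ y w, fderiv ℝ (fun z : EuclideanSpace ℝ (Fin 3) => η z ^ 2) y w = 2 * η y * fderiv ℝ η y w := fun y w => by
    have hd : DifferentiableAt ℝ η y := hη.differentiable (by norm_num) y
    rw [show (fun z : EuclideanSpace ℝ (Fin 3) => η z ^ 2) = fun z => η z * η z from funext fun z => sq (η z), fderiv_fun_mul hd hd]
    simp only [FunLike.coe_add, Pi.add_apply, FunLike.coe_smul, Pi.smul_apply, smul_eq_mul]; ring
  have hig : ∀ (g : EuclideanSpace ℝ (Fin 3) → ℝ) (y w : EuclideanSpace ℝ (Fin 3)), ⟪w, gradient g y⟫_ℝ = fderiv ℝ g y w := fun g y w => by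
    rw [real_inner_comm, gradient, InnerProductSpace.toDual_symm_apply]
  -- the three compactly supported `C¹` fields
  set A : EuclideanSpace ℝ (Fin 3) → EuclideanSpace ℝ (Fin 3) := fun z => (η z ^ 2) • gradient (fun z : EuclideanSpace ℝ (Fin 3) => ⟪Ω z, Ω z⟫_ℝ) z with hA
  set B : EuclideanSpace ℝ (Fin 3) → EuclideanSpace ℝ (Fin 3) :=
    fun z => (η z ^ 2 * ⟪Ω z, Ω z⟫_ℝ) • (U z + (1/2:ℝ) • z - α • cross (EuclideanSpace.single 2 1) z) with hB
  set C : EuclideanSpace ℝ (Fin 3) → EuclideanSpace ℝ (Fin 3) := fun z => ⟪Ω z, Ω z⟫_ℝ • gradient (fun z : EuclideanSpace ℝ (Fin 3) => η z ^ 2) z with hC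
  have hA1 : ContDiff ℝ 1 A := hθ1.smul hgq
  have hB1 : ContDiff ℝ 1 B := (hθ1.mul hq1).smul hv
  have hC1 : ContDiff ℝ 1 C := hq1.smul hgθ
  have hAc : HasCompactSupport A := HasCompactSupport.intro' hηc (isClosed_tsupport η) fun y hy => by simp only [hA, hθ0 y hy, zero_smul]
  have hBc : HasCompactSupport B := HasCompactSupport.intro' hηc (isClosed_tsupport η) fun y hy => by simp only [hB, hθ0 y hy, zero_mul, zero_smul]
  have hCc : HasCompactSupport C := HasCompactSupport.intro' hηc (isClosed_tsupport η) fun y hy => by simp only [hC, hgθ0 y hy, smul_zero]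
  -- their divergences
  have hdivA : ∀ y, VectorCalculus.divergence A y = η y ^ 2 * (Δ (fun z : EuclideanSpace ℝ (Fin 3) => ⟪Ω z, Ω z⟫_ℝ)) y
      + ⟪gradient (fun z : EuclideanSpace ℝ (Fin 3) => ⟪Ω z, Ω z⟫_ℝ) y, gradient (fun z : EuclideanSpace ℝ (Fin 3) => η z ^ 2) y⟫_ℝ := fun y => by
    rw [hA, divergence_smul_apply (hθ1.differentiable (by norm_num) y) (hgq.differentiable (by norm_num) y), divergence_gradient_eq_laplacian hq]
  have hdivB : ∀ y, VectorCalculus.divergence B y = (η y ^ 2 * ⟪Ω y, Ω y⟫_ℝ) * (3/2)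
      + (η y ^ 2 * fderiv ℝ (fun z : EuclideanSpace ℝ (Fin 3) => ⟪Ω z, Ω z⟫_ℝ) y (U y + (1/2:ℝ) • y - α • cross (EuclideanSpace.single 2 1) y)
        + ⟪Ω y, Ω y⟫_ℝ * (2 * η y * fderiv ℝ η y (U y + (1/2:ℝ) • y - α • cross (EuclideanSpace.single 2 1) y))) := fun y => by
    have hd1 : DifferentiableAt ℝ (fun z : EuclideanSpace ℝ (Fin 3) => η z ^ 2 * ⟪Ω z, Ω z⟫_ℝ) y :=
      (hθ1.differentiable (by norm_num) y).mul (hq1.differentiable (by norm_num) y)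
    rw [hB, divergence_smul_apply hd1 (hv.differentiable (by norm_num) y), divergence_frameField hU hdiv α y, hig,
      fderiv_fun_mul (hθ1.differentiable (by norm_num) y) (hq1.differentiable (by norm_num) y)]
    simp only [FunLike.coe_add, Pi.add_apply, FunLike.coe_smul, Pi.smul_apply, smul_eq_mul, hDθ]
  have hdivC : ∀ y, VectorCalculus.divergence C y = ⟪Ω y, Ω y⟫_ℝ * (Δ (fun z : EuclideanSpace ℝ (Fin 3) => η z ^ 2)) y
      + ⟪gradient (fun z : EuclideanSpace ℝ (Fin 3) => η z ^ 2) y, gradient (fun z : EuclideanSpace ℝ (Fin 3) => ⟪Ω z, Ω z⟫_ℝ) y⟫_ℝ := fun y => by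
    rw [hC, divergence_smul_apply (hq1.differentiable (by norm_num) y) (hgθ.differentiable (by norm_num) y), divergence_gradient_eq_laplacian hθ]
  -- the pointwise energy identity times `η²` is a divergence plus the claimed terms
  have hpt : ∀ y, 2 * (η y ^ 2 * frobeniusNormSq (fderiv ℝ Ω y)) + (1/2:ℝ) * (η y ^ 2 * ⟪Ω y, Ω y⟫_ℝ)
      - ⟪Ω y, Ω y⟫_ℝ * ((Δ (fun z : EuclideanSpace ℝ (Fin 3) => η z ^ 2)) y + 2 * η y * fderiv ℝ η y (U y + (1/2:ℝ) • y - α • cross (EuclideanSpace.single 2 1) y))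
      - 2 * (η y ^ 2 * ⟪fderiv ℝ U y (Ω y), Ω y⟫_ℝ)
      = VectorCalculus.divergence A y - VectorCalculus.divergence B y - VectorCalculus.divergence C y := by
    intro y
    have hE := inner_vorticityOp_eq α U hΩ y
    rw [hvort y, inner_zero_right, mul_zero] at hE
    rw [hdivA, hdivB, hdivC]
    have hcomm : ⟪gradient (fun z : EuclideanSpace ℝ (Fin 3) => η z ^ 2) y, gradient (fun z : EuclideanSpace ℝ (Fin 3) => ⟪Ω z, Ω z⟫_ℝ) y⟫_ℝ
        = ⟪gradient (fun z : EuclideanSpace ℝ (Fin 3) => ⟪Ω z, Ω z⟫_ℝ) y, gradient (fun z : EuclideanSpace ℝ (Fin 3) => η z ^ 2) y⟫_ℝ := real_inner_comm _ _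
    have h3 : η y ^ 2 * (-(Δ (fun z : EuclideanSpace ℝ (Fin 3) => ⟪Ω z, Ω z⟫_ℝ)) y
        + fderiv ℝ (fun z : EuclideanSpace ℝ (Fin 3) => ⟪Ω z, Ω z⟫_ℝ) y (U y + (1/2:ℝ) • y - α • cross (EuclideanSpace.single 2 1) y)
        + 2 * ⟪Ω y, Ω y⟫_ℝ - 2 * ⟪fderiv ℝ U y (Ω y), Ω y⟫_ℝ + 2 * frobeniusNormSq (fderiv ℝ Ω y)) = 0 := by
      rw [← hE, mul_zero]
    linarith [hcomm]
  -- integrate: each divergence integrates to zero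
  have hIA := integral_divergence_eq_zero hA1 hAc
  have hIB := integral_divergence_eq_zero hB1 hBc
  have hIC := integral_divergence_eq_zero hC1 hCc
  have idA : Integrable (fun y => VectorCalculus.divergence A y) :=
    (continuous_divergence (hA1.continuous_fderiv (by norm_num))).integrable_of_hasCompactSupport
      (hAc.mono' fun y hy => by contrapose! hy; simp [divergence_eq_zero_of_notMem_tsupport hy])
  have idB : Integrable (fun y => VectorCalculus.divergence B y) :=
    (continuous_divergence (hB1.continuous_fderiv (by norm_num))).integrable_of_hasCompactSupport
      (hBc.mono' fun y hy => by contrapose! hy; simp [divergence_eq_zero_of_notMem_tsupport hy])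
  have idC : Integrable (fun y => VectorCalculus.divergence C y) :=
    (continuous_divergence (hC1.continuous_fderiv (by norm_num))).integrable_of_hasCompactSupport
      (hCc.mono' fun y hy => by contrapose! hy; simp [divergence_eq_zero_of_notMem_tsupport hy])
  have idAB : Integrable (fun y => VectorCalculus.divergence A y - VectorCalculus.divergence B y) := idA.sub idB
  have hint0 := integral_congr_ae (μ := (volume : Measure (EuclideanSpace ℝ (Fin 3)))) (Filter.Eventually.of_forall hpt)
  rw [integral_sub idAB idC, integral_sub idA idB, hIA, hIB, hIC, sub_zero, sub_zero] at hint0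
  -- integrability of the four terms (continuous, supported in `tsupport η`)
  have hF : Continuous fun y => frobeniusNormSq (fderiv ℝ Ω y) := by
    have hDΩ : Continuous (fderiv ℝ Ω) := hΩ.continuous_fderiv (by norm_num)
    simp only [frobeniusNormSq_eq_sum (EuclideanSpace.basisFun (Fin 3) ℝ)]
    fun_prop
  have hΩc : Continuous Ω := hΩ.continuous
  have hUc : Continuous U := hU.continuous
  have hηc' : Continuous η := hη.continuous
  have hDη : Continuous (fderiv ℝ η) := hη.continuous_fderiv (by norm_num)
  have hDU : Continuous (fderiv ℝ U) := hU.continuous_fderiv (by norm_num)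
  have hΔθ : Continuous (Δ (fun z : EuclideanSpace ℝ (Fin 3) => η z ^ 2)) := continuous_laplacian hθ
  have hsupp : ∀ {g : EuclideanSpace ℝ (Fin 3) → ℝ}, (∀ y ∉ tsupport η, g y = 0) → HasCompactSupport g := fun hg =>
    HasCompactSupport.intro' hηc (isClosed_tsupport η) hg
  have i1 : Integrable (fun y => η y ^ 2 * frobeniusNormSq (fderiv ℝ Ω y)) :=
    Continuous.integrable_of_hasCompactSupport (by fun_prop) (hsupp fun y hy => by rw [hθ0 y hy, zero_mul])
  have i2 : Integrable (fun y => η y ^ 2 * ⟪Ω y, Ω y⟫_ℝ) :=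
    Continuous.integrable_of_hasCompactSupport (by fun_prop) (hsupp fun y hy => by rw [hθ0 y hy, zero_mul])
  have i3 : Integrable (fun y => ⟪Ω y, Ω y⟫_ℝ * ((Δ (fun z : EuclideanSpace ℝ (Fin 3) => η z ^ 2)) y
      + 2 * η y * fderiv ℝ η y (U y + (1/2:ℝ) • y - α • cross (EuclideanSpace.single 2 1) y))) := by
    refine Continuous.integrable_of_hasCompactSupport ?_ (hsupp fun y hy => ?_)
    · simp only [cross_single_two_eq_rotGenL]; fun_prop
    · rw [hΔθ0 y hy, image_eq_zero_of_notMem_tsupport hy]; ring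
  have i4 : Integrable (fun y => η y ^ 2 * ⟪fderiv ℝ U y (Ω y), Ω y⟫_ℝ) :=
    Continuous.integrable_of_hasCompactSupport (by fun_prop) (hsupp fun y hy => by rw [hθ0 y hy, zero_mul])
  -- assemble
  have j1 : Integrable (fun y => 2 * (η y ^ 2 * frobeniusNormSq (fderiv ℝ Ω y))) := i1.const_mul 2
  have j2 : Integrable (fun y => (1/2:ℝ) * (η y ^ 2 * ⟪Ω y, Ω y⟫_ℝ)) := i2.const_mul _
  have j4 : Integrable (fun y => 2 * (η y ^ 2 * ⟪fderiv ℝ U y (Ω y), Ω y⟫_ℝ)) := i4.const_mul 2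
  have j12 : Integrable (fun y => 2 * (η y ^ 2 * frobeniusNormSq (fderiv ℝ Ω y)) + (1/2:ℝ) * (η y ^ 2 * ⟪Ω y, Ω y⟫_ℝ)) := j1.add j2
  have j123 : Integrable (fun y => 2 * (η y ^ 2 * frobeniusNormSq (fderiv ℝ Ω y)) + (1/2:ℝ) * (η y ^ 2 * ⟪Ω y, Ω y⟫_ℝ)
      - ⟪Ω y, Ω y⟫_ℝ * ((Δ (fun z : EuclideanSpace ℝ (Fin 3) => η z ^ 2)) y
        + 2 * η y * fderiv ℝ η y (U y + (1/2:ℝ) • y - α • cross (EuclideanSpace.single 2 1) y))) := j12.sub i3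
  rw [integral_sub j123 j4, integral_sub j12 i3, integral_add j1 j2, integral_const_mul, integral_const_mul, integral_const_mul] at hint0
  linarith

/-- **CACCIOPPOLI ESTIMATE in a low-strain region.**  Under the hypotheses of `vorticity_caccioppoli_identity`, if the strain along the vorticity is bounded on the support of
the cut-off, `⟪DU·Ω, Ω⟫ ≤ s·|Ω|²` on `tsupport η`, then
`2∫ η²‖DΩ‖²_F + (½ − 2s)∫ η²|Ω|² ≤ ∫ |Ω|²·(Δ(η²) + 2ηDη[v])`:
for `s < ¼` both the gradient AND the mass of the vorticity under the cut-off are controlled by the mass of `|Ω|²` on the LAYER `{∇η ≠ 0}`, weighted by the drift. -/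
theorem vorticity_caccioppoli_estimate (α : ℝ) {U Ω : EuclideanSpace ℝ (Fin 3) → EuclideanSpace ℝ (Fin 3)} (hU : ContDiff ℝ 1 U)
    (hdiv : VectorCalculus.IsDivFree U) (hΩ : ContDiff ℝ 2 Ω)
    (hvort : ∀ y, α • (cross (EuclideanSpace.single 2 1) (Ω y) - fderiv ℝ Ω y (cross (EuclideanSpace.single 2 1) y)) + Ω y + (1/2:ℝ) • fderiv ℝ Ω y y
        - (Δ Ω) y + fderiv ℝ Ω y (U y) - fderiv ℝ U y (Ω y) = 0)
    {η : EuclideanSpace ℝ (Fin 3) → ℝ} (hη : ContDiff ℝ 2 η) (hηc : HasCompactSupport η)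
    {s : ℝ} (hstrain : ∀ y ∈ tsupport η, ⟪fderiv ℝ U y (Ω y), Ω y⟫_ℝ ≤ s * ⟪Ω y, Ω y⟫_ℝ) :
    2 * (∫ y, η y ^ 2 * frobeniusNormSq (fderiv ℝ Ω y)) + (1/2 - 2 * s) * (∫ y, η y ^ 2 * ⟪Ω y, Ω y⟫_ℝ)
      ≤ ∫ y, ⟪Ω y, Ω y⟫_ℝ * ((Δ (fun z => η z ^ 2)) y + 2 * η y * fderiv ℝ η y (U y + (1/2:ℝ) • y - α • cross (EuclideanSpace.single 2 1) y)) := by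
  have hid := vorticity_caccioppoli_identity α hU hdiv hΩ hvort hη hηc
  have hθ0 : ∀ y ∉ tsupport η, η y ^ 2 = 0 := fun y hy => by simp [image_eq_zero_of_notMem_tsupport hy]
  have hsupp : ∀ {g : EuclideanSpace ℝ (Fin 3) → ℝ}, (∀ y ∉ tsupport η, g y = 0) → HasCompactSupport g := fun hg =>
    HasCompactSupport.intro' hηc (isClosed_tsupport η) hg
  have hΩc : Continuous Ω := hΩ.continuous
  have hηc' : Continuous η := hη.continuous
  have hDU : Continuous (fderiv ℝ U) := hU.continuous_fderiv (by norm_num)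
  have i2 : Integrable (fun y => η y ^ 2 * ⟪Ω y, Ω y⟫_ℝ) :=
    Continuous.integrable_of_hasCompactSupport (by fun_prop) (hsupp fun y hy => by rw [hθ0 y hy, zero_mul])
  have i4 : Integrable (fun y => η y ^ 2 * ⟪fderiv ℝ U y (Ω y), Ω y⟫_ℝ) :=
    Continuous.integrable_of_hasCompactSupport (by fun_prop) (hsupp fun y hy => by rw [hθ0 y hy, zero_mul])
  -- `∫ η²⟪DU·Ω,Ω⟫ ≤ s ∫ η²|Ω|²`
  have hmono : ∫ y, η y ^ 2 * ⟪fderiv ℝ U y (Ω y), Ω y⟫_ℝ ≤ ∫ y, s * (η y ^ 2 * ⟪Ω y, Ω y⟫_ℝ) := by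
    refine integral_mono i4 (i2.const_mul s) fun y => ?_
    by_cases hy : y ∈ tsupport η
    · have h1 := hstrain y hy
      have h2 : 0 ≤ η y ^ 2 := sq_nonneg _
      simp only
      nlinarith
    · simp only
      rw [hθ0 y hy]; simp
  rw [integral_const_mul] at hmono
  nlinarith

end Summit.NavierStokesRegularity.NavierStokesRegularity.Theorems.DefectColumnGate

end
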